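import Summits.AnomalousDissipation.AnomalousDissipation.Theses.VirtualDissipation

/-!
# Crux `LightSteadyStatesGP` (stmt-AnomalousDissipation-15151, route VirtualDissipation, rank 3) — birth skeleton

`Lines/birth.lean`: the GLOBAL-CONTINUATION-BEHIND-A-WALL skeleton of the crux, in the cyclic⊕odd symmetry
class of the Galloway–Proctor force.  Two named stubs and the kernel-checked composition
`LightSteadyStatesGP_of : stub₁ → stub₂ → LightSteadyStatesGP` (hypotheses = the name-keyed aliases
`__Registered.stub_*` of the two stub signatures, see § aliases; wiring `example` at the end), concluding the
route decl `Summit.AnomalousDissipation.AnomalousDissipation.Theses.VirtualDissipation.LightSteadyStatesGP`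
BY NAME; sorries only inside the two `stub_*`.

The crux asks, for the pinned force `f_GP(x) = sin(2πx₂)e₀ + sin(2πx₀)e₁ + sin(2πx₁)e₂` on the unit torus
(inline sum of three Stokes modes, exactly the expression of the route file), for viscosities `ν_j ∈ (0,1]`,
`ν_j → 0`, and MEAN-ZERO classical steady states `(u_j, p_j)` of `NS_{ν_j}(f_GP)`
(`Torus.IsClassicalNSSolutionOn univ` on constant data) that are LIGHT: `∫|u_j|² ≤ 2`.
Existence of a mean-zero classical steady state at every `ν > 0` is in the tree (Leray–Schauder/Galerkin,
`Torus.Temam1979_exists_steadyWeakSolution_holds` + regularity `Torus.Temam1979_steadyWeakSolution_smooth_holds`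
+ pressure recovery, `Theorems…CensusInterior.exists_isSteadyNSState`); LIGHTNESS along `ν → 0` is the bet
(a priori only `∫|u|² ≤ 3/(32π⁴ν²)`).  The only known obstruction to a uniform energy bound for `f_GP` is the
pair of FAT LAMINAR HALF-BRANCHES `u ≈ h±/ν` (`h± = (f ± curl f)/2`, `∫|u|² = 0.75/((2π)⁴ν²)`, kit j015722,
`Cruxes/SteadyStatesLoudBounded/Lines/lojasiewicz-lamb-floor-ladder-dead.md`), and these are invisible in
the symmetry class used here: `f_GP` is ODD (`f(−x) = −f(x)`) and CYCLIC (`f(x ∘ r) = (f x) ∘ r`,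
`r = finRotate 3`), the Navier–Stokes map is equivariant under both isometries, so the closed subspace
`V_sym = {u : u(−x) = −u(x), u(x ∘ r) = (u x) ∘ r}` of mean-zero solenoidal fields is invariant, whereas
`curl f` is EVEN, so `h±/ν + O(ν)` is not odd (an odd Beltrami field is zero: `curl` flips parity).  The
hub's continuation of the primary cyclic⊕odd branch (refuter numerics kit j018975, NumericsJ018975.md on the
item) finds it LIGHT and LOUD down to `ν_box = 0.0144` (`E_unit: 0.86 → 1.02 ≤ 2`, `ε_unit ≈ 0.37` plateau;
caveat: energy creep exponent `≈ −0.25`, not yet saturating).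

THE LINE (the route header's two-layer plan "PrimaryBranchPersists: an analytic continuation/degree argument
in the cyclic-symmetric class", typed): global Leray–Schauder continuation of the symmetric steady states from
the viscous end `ν = 1` down to every `ν₀ ∈ (0,1]`, read through the continuous chart
`(ν, u) ↦ (ν, ∫|u|², ν‖∇u‖₂²)` (viscosity, energy, dissipation), plus a WALL in that chart — a continuous
functional `Φ(ν, E, D)` vanishing on no symmetric steady state, negative at the `ν = 1` states and
non-negative beyond energy `2`.  A continuum cannot cross a wall it never touches (intermediate value theorem on
a preconnected set), so its `ν₀`-end is light; `ν₀ := 1/(j+1)` gives the crux.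

* `stub_symmetricSteadyContinuumGP` (CONTINUUM; a KNOWN theorem — Leray–Schauder 1934 "continuation along a
  parameter" / Rabinowitz 1971 / Zeidler NFA I §14 — of size XL in Lean: Leray–Schauder degree for compact
  perturbations of the identity on `V_sym`, a priori bound `‖∇u‖₂ ≤ ‖f‖_{V'}/ν₀`, degree `1` by the homotopy
  `f ↦ sf`, Whyburn's lemma; regularity of fixed points by Temam Prop. 1.1 in tree): for every `ν₀ ∈ (0,1]`
  there is a preconnected `K ⊆ ℝ³` of chart values `(ν, ∫|u|², ν·gradNormSq u)` of cyclic⊕odd mean-zero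
  classical steady states of `NS_ν(f_GP)` with `ν ∈ (0,1]`, containing a point with `ν = 1` and a point with
  `ν = ν₀`.  About EXISTENCE-IN-FAMILIES only; says nothing about energies.
* `stub_symmetricWallGP` (WALL; the bet, the hardest stub mathematically): there is `Φ : ℝ³ → ℝ`, continuous
  on `{ν > 0}`, with (a) `Φ(ν, ∫|u|², ν‖∇u‖²) ≠ 0` for every cyclic⊕odd mean-zero classical steady state of
  `NS_ν(f_GP)`, `ν ∈ (0,1]`; (b) `Φ < 0` at the (symmetric) steady states of `NS_1(f_GP)` (which have
  `∫|u|² ≤ 3/(32π⁴) < 10⁻³` a priori, and are unique by the standard large-viscosity argument); (c) `Φ(ν, E, D) ≥ 0` whenever `E > 2`, `ν ∈ (0,1]`.  The simplest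
  instance is an ENERGY GAP `Φ = E − b(ν)` (`b ≤ 2` continuous, no symmetric steady state of `NS_ν(f_GP)` has
  energy exactly `b(ν)`); a strict symmetric ceiling (`∫|u|² < 2` for all symmetric steady states, all
  `ν ≤ 1`) is the instance `Φ = E − 2`; the dissipation coordinate lets a wall use the steady energy identity
  `ν‖∇u‖² = (f_GP, u) ≤ √(3E/2)` and loudness floors (the route's crux LambRigidGP frees the light-and-quiet
  corner `{E ≤ E₀, D < c}` at small `ν`).  Why it might fail: the primary symmetric branch itself creeps past
  energy `2` (local exponent −0.25 at `ν_box = 0.014`; crossing near `ν_box ~ 10⁻³` if sustained), or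
  secondary symmetric branches (bifurcations at the det-sign changes / the pseudo-time instability below
  `ν_box ≈ 0.03`) tile the chart between the primary component and `{E ≥ 2}` leaving no gap.

Composition (`LightSteadyStatesGP_of`, no sorry): fix `j`, `ν₀ := 1/(j+1) ∈ (0,1]`; stub 1 gives a
preconnected `K` with a `ν = 1` point `a` and a `ν = ν₀` point `z`, each realised by a symmetric steady state;
`q ↦ Φ(q)` is continuous on `K ⊆ {ν > 0} × ℝ²`; `Φ(a) < 0` by (b); if the state realising `z` had energy
`> 2` then `Φ(z) ≥ 0` by (c), and `IsPreconnected.intermediate_value₂` yields `q ∈ K` with `Φ(q) = 0`,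
contradicting (a) at the state realising `q`.  Hence the `z`-state is a mean-zero classical steady state of
`NS_{ν₀}(f_GP)` with `∫|u|² ≤ 2`; `choose` over `j` and `tendsto_one_div_add_atTop_nhds_zero_nat`.

Disproof used: none relevant — `ledger crux ls stmt-AnomalousDissipation-15151` lists no workfiles (no
`Disproof.lean`, no `Negative/` lemma) at registration.  Negatives index (6 refuted statements of the summit):
the two GP statements there (FrustratedForces.GPEnergyCeiling stmt-2979, EnsembleCeilingBridge stmt-2984) are
ANY-MEAN / Leray–Hopf energy CEILINGS killed by Galilean-drift data; both stubs here quantify over MEAN-ZERO,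
ODD steady states (drift states are not odd) and stub 2 is a gap, not a ceiling over all solutions.  The dead
line `lojasiewicz-lamb-floor-ladder` died at the ∀-ceiling `stub_gpSteadyCeiling` over ALL admissible steady
states (fat half-branches); the class here excludes its witness by parity.

Hardest stub: `stub_symmetricWallGP`.  Sources: Temam1979 Ch. II Thm 1.2 / Prop. 1.1 (tree:
`Torus.Temam1979_exists_steadyWeakSolution_holds`, `Torus.Temam1979_steadyWeakSolution_smooth_holds`);
Leray–Schauder 1934 (Ann. ENS 51) §III; Rabinowitz 1971 (J. Funct. Anal. 7, Thm 1.3); Zeidler, Nonlinear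
Functional Analysis I, §14; FoiasManleyRosaTemam2001 Ch. II; arXiv:2402.13346 §4; item evidence
NumericsJ006377.md / NumericsJ018975.md (primary cyclic⊕odd branch), lojasiewicz-lamb-floor-ladder-dead.md
(fat half-branches, parity).
-/

-- `Summit.<Summit>.<Problem>` is the tree's mandated summit-side namespace (CONVENTIONS §2); for this
-- single-conjunct summit the two coincide, so the duplicate is deliberate.
set_option linter.dupNamespace false

noncomputable section

open Filter Set Topology MeasureTheory

namespace Summit.AnomalousDissipation.AnomalousDissipation.Cruxes.LightSteadyStatesGP.Birth

/-- **stub 1 — the Leray–Schauder continuum of cyclic⊕odd steady GP states** (known theorem; size XL in Lean).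
For every `ν₀ ∈ (0,1]` there is a preconnected set `K ⊆ ℝ × ℝ × ℝ` of chart values
`(ν, ∫|u|², ν·gradNormSq u)` — viscosity, energy, dissipation — each REALISED by a classical steady state
`(u, p)` of `NS_ν(f_GP)` (`Torus.IsClassicalNSSolutionOn univ ν` on constant data, exactly as in the crux) that
is mean-zero, ODD (`u(−x) = −u(x)`) and CYCLIC (`u(x ∘ r) i = u x (r i)`, `r = finRotate 3`, the symmetry of
`f_GP`), with `ν ∈ (0,1]`, and `K` contains a point with `ν = 1` and a point with `ν = ν₀`.  Why true: the
steady map `u ↦ (νA)⁻¹P(f_GP − B(u,u))` is compact on the closed invariant subspace `V_sym` (NS is equivariant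
under the isometries `x ↦ −x`, `x ↦ x ∘ r`; `f_GP ∈ V_sym`), fixed points obey `‖∇u‖₂ ≤ ‖f_GP‖_{V'}/ν`, the
Leray–Schauder degree on a large ball is `1` for every `ν` (homotopy `f ↦ sf`), so the solution set over
`[ν₀, 1]` contains a continuum joining the two ends (Leray–Schauder 1934 §III; Rabinowitz 1971 Thm 1.3;
Zeidler NFA I §14); fixed points in `V` are smooth classical steady states with a smooth pressure (Temam 1979
Ch. II Prop. 1.1, tree `Torus.Temam1979_steadyWeakSolution_smooth_holds` + pressure recovery as in
`Theorems…CensusInterior.exists_isSteadyNSState`), and the chart is continuous on `ℝ × H¹`.  Why it might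
fail: only formally (Leray–Schauder degree theory is not in Mathlib; the tree has Brouwer/Schauder fixed
points and an analytic Brouwer degree on the torus, not the continuation theorem). -/
theorem stub_symmetricSteadyContinuumGP :
    ∀ ν₀ : ℝ, 0 < ν₀ → ν₀ ≤ 1 → ∃ K : Set (ℝ × ℝ × ℝ), IsPreconnected K ∧ (∀ q ∈ K, 0 < q.1 ∧ q.1 ≤ 1 ∧ ∃ (u : UnitAddTorus (Fin 3) → EuclideanSpace ℝ (Fin 3)) (p : UnitAddTorus (Fin 3) → ℝ), (Literature.Analysis.FunctionSpaces.Torus.IsClassicalNSSolutionOn Set.univ q.1 (fun _ => fun x : UnitAddTorus (Fin 3) => (Literature.Analysis.FluidPDE.Torus.stokesMode (Pi.single (2 : Fin 3) (1 : ℤ)) (EuclideanSpace.single (0 : Fin 3) (1 : ℝ)) false x + Literature.Analysis.FluidPDE.Torus.stokesMode (Pi.single (0 : Fin 3) (1 : ℤ)) (EuclideanSpace.single (1 : Fin 3) (1 : ℝ)) false x + Literature.Analysis.FluidPDE.Torus.stokesMode (Pi.single (1 : Fin 3) (1 : ℤ)) (EuclideanSpace.single (2 : Fin 3) (1 : ℝ))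 false x : EuclideanSpace ℝ (Fin 3))) (fun _ => u) (fun _ => p) ∧ Literature.Analysis.FunctionSpaces.Torus.HasZeroMean u ∧ (∀ x : UnitAddTorus (Fin 3), u (-x) = -u x) ∧ (∀ (x : UnitAddTorus (Fin 3)) (i : Fin 3), u (fun k => x (finRotate 3 k)) i = u x (finRotate 3 i))) ∧ ∫ x, ‖u x‖ ^ 2 = q.2.1 ∧ q.1 * Literature.Analysis.FunctionSpaces.Torus.gradNormSq u = q.2.2) ∧ (∃ q ∈ K, q.1 = 1) ∧ (∃ q ∈ K, q.1 = ν₀) := by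
  sorry

/-- **stub 2 — a wall in the (viscosity, energy, dissipation) chart** (the bet; the hardest stub).  There is
`Φ : ℝ → ℝ → ℝ → ℝ`, continuous on `{ν > 0}`, such that (a) `Φ ν (∫|u|²) (ν·gradNormSq u) ≠ 0` for every
cyclic⊕odd mean-zero classical steady state `(u,p)` of `NS_ν(f_GP)` with `ν ∈ (0,1]`; (b) `Φ 1 (∫|u|²)
(gradNormSq u) < 0` for every such state at `ν = 1` (a priori `∫|u|² ≤ 3/(32π⁴)`, `gradNormSq u ≤ 3/(8π²)`
there); (c) `0 ≤ Φ ν E D` whenever `ν ∈ (0,1]` and `E > 2`.  Instances: an energy gap `Φ = E − b(ν)` with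
`b ≤ 2` continuous and no symmetric steady state of energy exactly `b(ν)`; the strict symmetric ceiling
`Φ = E − 2`; walls bent along the dissipation axis using `ν‖∇u‖² = (f_GP,u) ≤ √(3E/2)` and loudness floors.
Why plausibly true: in the cyclic⊕odd class the fat laminar half-branches `h±/ν` are absent (parity), the
primary branch is light and loud down to `ν_box = 0.0144` (`E_unit ≤ 1.02`, kit j018975), and at `ν = 1` every
steady state has energy `≤ 3/(32π⁴) < 10⁻³` (energy identity + Poincaré).  Why it might fail: the primary symmetric branch creeps past energy
`2` (local exponent ≈ −0.25, crossing near `ν_box ~ 10⁻³` if sustained), or secondary symmetric branches leave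
no gap between the primary component and `{E ≥ 2}`. -/
theorem stub_symmetricWallGP :
    ∃ Φ : ℝ → ℝ → ℝ → ℝ, ContinuousOn (fun q : ℝ × ℝ × ℝ => Φ q.1 q.2.1 q.2.2) (Set.Ioi (0 : ℝ) ×ˢ (Set.univ : Set (ℝ × ℝ))) ∧ (∀ ν : ℝ, 0 < ν → ν ≤ 1 → ∀ (u : UnitAddTorus (Fin 3) → EuclideanSpace ℝ (Fin 3)) (p : UnitAddTorus (Fin 3) → ℝ), (Literature.Analysis.FunctionSpaces.Torus.IsClassicalNSSolutionOn Set.univ ν (fun _ => fun x : UnitAddTorus (Fin 3) => (Literature.Analysis.FluidPDE.Torus.stokesMode (Pi.single (2 : Fin 3) (1 : ℤ)) (EuclideanSpace.single (0 : Fin 3) (1 : ℝ)) false x + Literature.Analysis.FluidPDE.Torus.stokesMode (Pi.single (0 : Fin 3) (1 : ℤ)) (EuclideanSpace.single (1 : Fin 3) (1 : ℝ)) false x + Literature.Analysis.FluidPDE.Torus.stokesMode (Pi.single (1 : Fin 3) (1 : ℤ)) (EuclideanSpace.single (2 : Fin 3) (1 : ℝ)) false x : EuclideanSpace ℝ (Fin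 3))) (fun _ => u) (fun _ => p) ∧ Literature.Analysis.FunctionSpaces.Torus.HasZeroMean u ∧ (∀ x : UnitAddTorus (Fin 3), u (-x) = -u x) ∧ (∀ (x : UnitAddTorus (Fin 3)) (i : Fin 3), u (fun k => x (finRotate 3 k)) i = u x (finRotate 3 i))) → Φ ν (∫ x, ‖u x‖ ^ 2) (ν * Literature.Analysis.FunctionSpaces.Torus.gradNormSq u) ≠ 0) ∧ (∀ (u : UnitAddTorus (Fin 3) → EuclideanSpace ℝ (Fin 3)) (p : UnitAddTorus (Fin 3) → ℝ), (Literature.Analysis.FunctionSpaces.Torus.IsClassicalNSSolutionOn Set.univ 1 (fun _ => fun x : UnitAddTorus (Fin 3) => (Literature.Analysis.FluidPDE.Torus.stokesMode (Pi.single (2 : Fin 3) (1 : ℤ)) (EuclideanSpace.single (0 : Fin 3) (1 : ℝ)) false x + Literature.Analysis.FluidPDE.Torus.stokesMode (Pi.single (0 : Fin 3) (1 : ℤ)) (EuclideanSpace.single (1 : Fin 3) (1 : ℝ)) false x + Literature.Analysis.FluidPDE.Torus.stokesMode (Pi.single (1 : Fin 3) (1 : ℤ)) (EuclideanSpace.single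 (2 : Fin 3) (1 : ℝ)) false x : EuclideanSpace ℝ (Fin 3))) (fun _ => u) (fun _ => p) ∧ Literature.Analysis.FunctionSpaces.Torus.HasZeroMean u ∧ (∀ x : UnitAddTorus (Fin 3), u (-x) = -u x) ∧ (∀ (x : UnitAddTorus (Fin 3)) (i : Fin 3), u (fun k => x (finRotate 3 k)) i = u x (finRotate 3 i))) → Φ 1 (∫ x, ‖u x‖ ^ 2) (Literature.Analysis.FunctionSpaces.Torus.gradNormSq u) < 0) ∧ (∀ ν E D : ℝ, 0 < ν → ν ≤ 1 → 2 < E → 0 ≤ Φ ν E D) := by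
  sorry

/-! ## Name-keyed aliases of the two stub statements — the hypotheses of `LightSteadyStatesGP_of`

The native skeleton audit (`#h21_check_skeleton`, run by `ledger skeleton check`) admits a hypothesis of the
composing theorem only if its head constant is a registered obligation or is NAMED like a declared stub;
`__Registered.stub_X` is the statement of `stub_X` verbatim under the stub's short name (device of
`Cruxes/GPLoudFamilyZ/Lines/birth.lean`).  Each alias is an `abbrev`, definitionally (and textually) its stub's
signature — generated from the same source text. -/
namespace __Registered

/-- Alias of the statement of `stub_symmetricSteadyContinuumGP` (Leray–Schauder continuum of symmetric steady
GP states), keyed by the stub name. -/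
abbrev stub_symmetricSteadyContinuumGP : Prop :=
  ∀ ν₀ : ℝ, 0 < ν₀ → ν₀ ≤ 1 → ∃ K : Set (ℝ × ℝ × ℝ), IsPreconnected K ∧ (∀ q ∈ K, 0 < q.1 ∧ q.1 ≤ 1 ∧ ∃ (u : UnitAddTorus (Fin 3) → EuclideanSpace ℝ (Fin 3)) (p : UnitAddTorus (Fin 3) → ℝ), (Literature.Analysis.FunctionSpaces.Torus.IsClassicalNSSolutionOn Set.univ q.1 (fun _ => fun x : UnitAddTorus (Fin 3) => (Literature.Analysis.FluidPDE.Torus.stokesMode (Pi.single (2 : Fin 3) (1 : ℤ)) (EuclideanSpace.single (0 : Fin 3) (1 : ℝ)) false x + Literature.Analysis.FluidPDE.Torus.stokesMode (Pi.single (0 : Fin 3) (1 : ℤ)) (EuclideanSpace.single (1 : Fin 3) (1 : ℝ)) false x + Literature.Analysis.FluidPDE.Torus.stokesMode (Pi.single (1 : Fin 3) (1 : ℤ)) (EuclideanSpace.single (2 : Fin 3) (1 : ℝ)) false x : EuclideanSpace ℝ (Fin 3))) (fun _ => u) (fun _ => p) ∧ Literature.Analysis.FunctionSpaces.Torus.HasZeroMean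 u ∧ (∀ x : UnitAddTorus (Fin 3), u (-x) = -u x) ∧ (∀ (x : UnitAddTorus (Fin 3)) (i : Fin 3), u (fun k => x (finRotate 3 k)) i = u x (finRotate 3 i))) ∧ ∫ x, ‖u x‖ ^ 2 = q.2.1 ∧ q.1 * Literature.Analysis.FunctionSpaces.Torus.gradNormSq u = q.2.2) ∧ (∃ q ∈ K, q.1 = 1) ∧ (∃ q ∈ K, q.1 = ν₀)

/-- Alias of the statement of `stub_symmetricWallGP` (a wall in the viscosity–energy–dissipation chart),
keyed by the stub name. -/
abbrev stub_symmetricWallGP : Prop :=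
  ∃ Φ : ℝ → ℝ → ℝ → ℝ, ContinuousOn (fun q : ℝ × ℝ × ℝ => Φ q.1 q.2.1 q.2.2) (Set.Ioi (0 : ℝ) ×ˢ (Set.univ : Set (ℝ × ℝ))) ∧ (∀ ν : ℝ, 0 < ν → ν ≤ 1 → ∀ (u : UnitAddTorus (Fin 3) → EuclideanSpace ℝ (Fin 3)) (p : UnitAddTorus (Fin 3) → ℝ), (Literature.Analysis.FunctionSpaces.Torus.IsClassicalNSSolutionOn Set.univ ν (fun _ => fun x : UnitAddTorus (Fin 3) => (Literature.Analysis.FluidPDE.Torus.stokesMode (Pi.single (2 : Fin 3) (1 : ℤ)) (EuclideanSpace.single (0 : Fin 3) (1 : ℝ)) false x + Literature.Analysis.FluidPDE.Torus.stokesMode (Pi.single (0 : Fin 3) (1 : ℤ)) (EuclideanSpace.single (1 : Fin 3) (1 : ℝ)) false x + Literature.Analysis.FluidPDE.Torus.stokesMode (Pi.single (1 : Fin 3) (1 : ℤ)) (EuclideanSpace.single (2 : Fin 3) (1 : ℝ)) false x : EuclideanSpace ℝ (Fin 3))) (fun _ => u) (fun _ => p) ∧ Literature.Analysis.FunctionSpaces.Torus.HasZeroMean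 u ∧ (∀ x : UnitAddTorus (Fin 3), u (-x) = -u x) ∧ (∀ (x : UnitAddTorus (Fin 3)) (i : Fin 3), u (fun k => x (finRotate 3 k)) i = u x (finRotate 3 i))) → Φ ν (∫ x, ‖u x‖ ^ 2) (ν * Literature.Analysis.FunctionSpaces.Torus.gradNormSq u) ≠ 0) ∧ (∀ (u : UnitAddTorus (Fin 3) → EuclideanSpace ℝ (Fin 3)) (p : UnitAddTorus (Fin 3) → ℝ), (Literature.Analysis.FunctionSpaces.Torus.IsClassicalNSSolutionOn Set.univ 1 (fun _ => fun x : UnitAddTorus (Fin 3) => (Literature.Analysis.FluidPDE.Torus.stokesMode (Pi.single (2 : Fin 3) (1 : ℤ)) (EuclideanSpace.single (0 : Fin 3) (1 : ℝ)) false x + Literature.Analysis.FluidPDE.Torus.stokesMode (Pi.single (0 : Fin 3) (1 : ℤ)) (EuclideanSpace.single (1 : Fin 3) (1 : ℝ)) false x + Literature.Analysis.FluidPDE.Torus.stokesMode (Pi.single (1 : Fin 3) (1 : ℤ)) (EuclideanSpace.single (2 : Fin 3) (1 : ℝ)) false x : EuclideanSpace ℝ (Fin 3))) (fun _ => u) (fun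 _ => p) ∧ Literature.Analysis.FunctionSpaces.Torus.HasZeroMean u ∧ (∀ x : UnitAddTorus (Fin 3), u (-x) = -u x) ∧ (∀ (x : UnitAddTorus (Fin 3)) (i : Fin 3), u (fun k => x (finRotate 3 k)) i = u x (finRotate 3 i))) → Φ 1 (∫ x, ‖u x‖ ^ 2) (Literature.Analysis.FunctionSpaces.Torus.gradNormSq u) < 0) ∧ (∀ ν E D : ℝ, 0 < ν → ν ≤ 1 → 2 < E → 0 ≤ Φ ν E D)

end __Registered

/-- **Composition** (kernel-checked, no `sorry` of its own): the two stub statements (as the name-keyed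
aliases `__Registered.stub_*`) imply the crux
`Summit.AnomalousDissipation.AnomalousDissipation.Theses.VirtualDissipation.LightSteadyStatesGP` BY NAME.
At each `ν₀ = 1/(j+1)`: the continuum `K` of stub 1 joins a `ν = 1` chart point `a` (where the wall functional
is negative, stub 2 (b)) to a `ν = ν₀` chart point `z`; were the state realising `z` heavier than `2`, the wall
functional would be non-negative at `z` (stub 2 (c)) and vanish somewhere on the preconnected `K`
(`IsPreconnected.intermediate_value₂`), i.e. at a symmetric steady state — excluded by stub 2 (a).  So the
`z`-state is a light mean-zero classical steady state of `NS_{ν₀}(f_GP)`; `choose` over `j`,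
`ν_j = 1/(j+1) → 0` (`tendsto_one_div_add_atTop_nhds_zero_nat`). [folklore] -/
theorem LightSteadyStatesGP_of :
    __Registered.stub_symmetricSteadyContinuumGP → __Registered.stub_symmetricWallGP →
      Summit.AnomalousDissipation.AnomalousDissipation.Theses.VirtualDissipation.LightSteadyStatesGP := by
  intro hK hW
  dsimp only [__Registered.stub_symmetricSteadyContinuumGP, __Registered.stub_symmetricWallGP] at hK hW
  obtain ⟨Φ, hΦ, hwall, hstart, hheavy⟩ := hW
  -- at every `ν₀ ∈ (0,1]`: a mean-zero classical steady state of `NS_{ν₀}(f_GP)` of energy `≤ 2`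
  have key : ∀ ν₀ : ℝ, 0 < ν₀ → ν₀ ≤ 1 →
      ∃ (u : UnitAddTorus (Fin 3) → EuclideanSpace ℝ (Fin 3)) (p : UnitAddTorus (Fin 3) → ℝ),
        Literature.Analysis.FunctionSpaces.Torus.IsClassicalNSSolutionOn Set.univ ν₀ (fun _ => fun x : UnitAddTorus (Fin 3) => (Literature.Analysis.FluidPDE.Torus.stokesMode (Pi.single (2 : Fin 3) (1 : ℤ)) (EuclideanSpace.single (0 : Fin 3) (1 : ℝ)) false x + Literature.Analysis.FluidPDE.Torus.stokesMode (Pi.single (0 : Fin 3) (1 : ℤ)) (EuclideanSpace.single (1 : Fin 3) (1 : ℝ)) false x + Literature.Analysis.FluidPDE.Torus.stokesMode (Pi.single (1 : Fin 3) (1 : ℤ)) (EuclideanSpace.single (2 : Fin 3) (1 : ℝ)) false x : EuclideanSpace ℝ (Fin 3))) (fun _ => u) (fun _ => p) ∧ Literature.Analysis.FunctionSpaces.Torus.HasZeroMean u ∧ ∫ x, ‖u x‖ ^ 2 ≤ 2 := by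
    intro ν₀ h0 h1
    obtain ⟨K, hKc, hKr, ⟨a, haK, ha1⟩, ⟨z, hzK, hz1⟩⟩ := hK ν₀ h0 h1
    obtain ⟨hz0, hzle, u, p, ⟨hsol, hmean, -, -⟩, hE, hD⟩ := hKr z hzK
    refine ⟨u, p, ?_, hmean, ?_⟩
    · rw [hz1] at hsol
      exact hsol
    · refine not_lt.1 fun hgt => ?_
      -- the wall functional read on the chart
      have hgc : ContinuousOn (fun q : ℝ × ℝ × ℝ => Φ q.1 q.2.1 q.2.2) K :=
        hΦ.mono fun q hq => Set.mk_mem_prod (Set.mem_Ioi.2 (hKr q hq).1) (Set.mem_univ _)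
      -- the `ν = 1` end lies on the negative side of the wall
      have ha : (fun q : ℝ × ℝ × ℝ => Φ q.1 q.2.1 q.2.2) a ≤ (fun _ : ℝ × ℝ × ℝ => (0 : ℝ)) a := by
        obtain ⟨-, -, ua, pa, hsa, hEa, hDa⟩ := hKr a haK
        rw [ha1] at hsa
        have h := hstart ua pa hsa
        show Φ a.1 a.2.1 a.2.2 ≤ 0
        rw [← hEa, ← hDa, ha1, one_mul]
        exact h.le
      -- the `ν₀` end, being heavy, lies on the non-negative side
      have hz : (fun _ : ℝ × ℝ × ℝ => (0 : ℝ)) z ≤ (fun q : ℝ × ℝ × ℝ => Φ q.1 q.2.1 q.2.2) z := by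
        show 0 ≤ Φ z.1 z.2.1 z.2.2
        rw [← hE]
        exact hheavy z.1 (∫ x, ‖u x‖ ^ 2) z.2.2 hz0 hzle hgt
      -- so the wall meets the continuum: a symmetric steady state ON the wall, excluded by stub 2 (a)
      obtain ⟨q, hqK, hq⟩ := hKc.intermediate_value₂ haK hzK hgc continuousOn_const ha hz
      obtain ⟨hq0, hqle, uq, pq, hsq, hEq, hDq⟩ := hKr q hqK
      have hne := hwall q.1 hq0 hqle uq pq hsq
      rw [hEq, hDq] at hne
      exact hne hq
  -- the vanishing-viscosity sequence `ν_j = 1/(j+1)`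
  have hνpos : ∀ j : ℕ, (0 : ℝ) < 1 / ((j : ℝ) + 1) := fun j => Nat.one_div_pos_of_nat
  have hνle : ∀ j : ℕ, 1 / ((j : ℝ) + 1) ≤ (1 : ℝ) := fun j => by
    rw [div_le_one (Nat.cast_add_one_pos j)]
    linarith [(Nat.cast_nonneg j : (0 : ℝ) ≤ j)]
  choose u p hsol hmean hE using fun j : ℕ => key (1 / ((j : ℝ) + 1)) (hνpos j) (hνle j)
  exact ⟨fun j => 1 / ((j : ℝ) + 1), u, p, fun j => ⟨hνpos j, hνle j⟩,
    tendsto_one_div_add_atTop_nhds_zero_nat, hsol, hmean, hE⟩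

/-- WIRING CHECK: the two sorried stubs compose to a closed term of the crux's type (modulo their `sorry`s).
Deliberately an `example` (no constant enters the environment), so that a BC3 probe importing this file could
not close `stub → LightSteadyStatesGP` by `exact?` through a pre-composed witness. -/
example : Summit.AnomalousDissipation.AnomalousDissipation.Theses.VirtualDissipation.LightSteadyStatesGP :=
  LightSteadyStatesGP_of stub_symmetricSteadyContinuumGP stub_symmetricWallGP

end Summit.AnomalousDissipation.AnomalousDissipation.Cruxes.LightSteadyStatesGP.Birth

end
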